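import Summits.NavierStokesRegularity.NavierStokesRegularity.Theorems.EulerZoomLiouvillePowerGaugeEulerLiouvilleWeakBernoulliBandsMember
import Summits.NavierStokesRegularity.NavierStokesRegularity.Theorems.EulerZoomLiouvillePowerGaugeEulerLiouvilleWeakFastSetThin

/-!
# THE HOVERING SET AND THE BERNOULLI LEVEL SETS OF A WEAK CLASS PROFILE ARE SOBOLEV-THIN FAR OUT (rate `3+3ρ`, no regularity)
# (crux `EulerZoomLiouville.PowerGaugeEulerLiouville` = stmt-NavierStokesRegularity-19832, line `birth`, open stub `stub_selfSimilarWeakRest`)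

Width seat `ns-ezl-w1` (g7) under the crux LEAD.  Two cheap but structural corollaries of g6's weak fast-set thinness
(`WeakThin.volume_fastSet_inter_far_le_of_past`: `vol({a|y| ≤ |V|} ∩ {R ≤ |y|}) ≤ K R^{−3−3ρ}`, NO regularity) and of «NO BERNOULLI PLATEAUS»
(`WeakRenormalized.volume_level_inter_eq_zero`):

* `WeakRenormalized.norm_ge_of_norm_transport_le` — a HOVERING point is FAST for `V`: `‖W y‖ ≤ ε‖y‖` (`W = γy + V`) ⇒ `(γ − ε)‖y‖ ≤ ‖V y‖`
  (on the similarity-stagnation set `V = −γy` exactly);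
* **`WeakRenormalized.volume_hoverSet_inter_far_le_of_past` / `_of_selfSimilar`** — crux hypotheses verbatim, `0 < ρ ≤ ½`, `0 < ε < γ = 1/(2+ρ)` ⇒
  `vol({‖W‖ ≤ ε‖y‖} ∩ {R ≤ ‖y‖}) ≤ K R^{−3−3ρ}` beyond a radius: the HOVERING FACE of the portrait (RESIDUE-MEMO-19832 §5/§7: the condenser,
  `W → 0`) lives, in the weak class too, on a Sobolev-thin set — the `A`/`E` budgets see hovering fluid as fast fluid (`|V| ≈ γ|y|`);
* **`WeakRenormalized.volume_level_inter_far_le_of_past` / `_of_selfSimilar`** — for EVERY level `m`: `vol({ℋ = m} ∩ {R ≤ ‖y‖}) ≤ K R^{−3−3ρ}`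
  beyond a radius (the level set is null off `{W = 0}` by «no plateaus», and `{W = 0}` is hovering): the Bernoulli LEVEL sets of a genuinely weak
  exactly self-similar member are Sobolev-thin far out although `ℋ` is merely `W^{1,1}_loc`.

WHAT THIS IS NOT: not NS, not E, not the stub — weak-class portrait tools (`--supports` stmt-19832); no summit statement is proved here; 19832 OPEN.
[folklore; cf. ConstantinIgnatovaVicol2026Putative §3.4.3 (3.30)–(3.31)]
-/

noncomputable section

set_option linter.dupNamespace false
-- nested operator types (`innerSL … ∘L …`)
set_option maxSynthPendingDepth 3

open MeasureTheory Set Filter Topology Metric Function TopologicalSpace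
open scoped ENNReal NNReal RealInnerProductSpace ContDiff

namespace Summit.NavierStokesRegularity.NavierStokesRegularity.Theorems.PowerGaugeEulerLiouville

open Literature.Analysis Literature.Analysis.FunctionSpaces Literature.Analysis.FluidPDE

namespace WeakRenormalized

variable {V : EuclideanSpace ℝ (Fin 3) → EuclideanSpace ℝ (Fin 3)} {P : EuclideanSpace ℝ (Fin 3) → ℝ}

/-! ## Hovering points are fast for `V` -/

/-- **A hovering point is fast**: `‖W y‖ ≤ ε‖y‖` (`W = γy + V`) ⇒ `(γ − ε)‖y‖ ≤ ‖V y‖` (`V y = W y − γy` and the triangle inequality). [folklore] -/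
theorem norm_ge_of_norm_transport_le {γ ε : ℝ} (hγ : 0 ≤ γ) {y : EuclideanSpace ℝ (Fin 3)}
    (hy : ‖selfSimilarTransport γ 0 V y‖ ≤ ε * ‖y‖) : (γ - ε) * ‖y‖ ≤ ‖V y‖ := by
  have e : V y = selfSimilarTransport γ 0 V y - γ • y := by
    rw [selfSimilarTransport_apply, sub_zero, add_sub_cancel_left]
  have h1 : ‖γ • y‖ - ‖selfSimilarTransport γ 0 V y‖ ≤ ‖V y‖ := by
    rw [e]
    have := norm_sub_norm_le (γ • y) (selfSimilarTransport γ 0 V y)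
    rw [← norm_neg (γ • y - selfSimilarTransport γ 0 V y), neg_sub] at this
    linarith [abs_sub_abs_le_abs_sub ‖γ • y‖ ‖selfSimilarTransport γ 0 V y‖,
      le_abs_self (‖γ • y‖ - ‖selfSimilarTransport γ 0 V y‖), norm_sub_norm_le (γ • y) (selfSimilarTransport γ 0 V y)]
  rw [norm_smul, Real.norm_of_nonneg hγ] at h1
  linarith

/-! ## Member level -/

section Member

/-- **THE HOVERING SET OF A PAST-EXACT SELF-SIMILAR CLASS MEMBER IS SOBOLEV-THIN FAR OUT** (`0 < ρ ≤ ½`, `γ = 1/(2+ρ)`, `0 < ε < γ`; NO regularity):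
crux hypotheses verbatim, exact self-similarity about `(T, x₀)` for `τ < T₁` ⇒ `∃ K ≥ 0, L₀: vol({‖W y‖ ≤ ε‖y‖} ∩ {R ≤ ‖y‖}) ≤ K R^{−3−3ρ}` for all
`R ≥ L₀` (the hovering set lies in the fast set `{(γ−ε)‖y‖ ≤ ‖V‖}`, `WeakThin.volume_fastSet_inter_far_le_of_past`). [folklore] -/
theorem volume_hoverSet_inter_far_le_of_past {ρ : ℝ} (hρ : 0 < ρ) (hρh : ρ ≤ 1 / 2)
    {T T₁ : ℝ} (hT₁ : T₁ ≤ 0) (hTT₁ : T₁ ≤ T) (x₀ : EuclideanSpace ℝ (Fin 3))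
    {u : ℝ → EuclideanSpace ℝ (Fin 3) → EuclideanSpace ℝ (Fin 3)} {p : ℝ → EuclideanSpace ℝ (Fin 3) → ℝ}
    {H : ℝ → EuclideanSpace ℝ (Fin 3) → EuclideanSpace ℝ (Fin 3) →L[ℝ] EuclideanSpace ℝ (Fin 3)} {c : ℝ≥0}
    (hsw : IsSuitableWeakSolutionOn (slab (EuclideanSpace ℝ (Fin 3)) (Iio 0) isOpen_Iio) 0 0 u p)
    (hH : HasWeakSpatialGradientOn (slab (EuclideanSpace ℝ (Fin 3)) (Iio 0) isOpen_Iio) u H)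
    (hgauge : ∀ a : ℝ, 0 < a →
      ENNReal.ofReal (a ^ (2 * ρ)) * cknA a (0 : ℝ × EuclideanSpace ℝ (Fin 3)) u +
          ENNReal.ofReal (a ^ ρ) * cknE a (0 : ℝ × EuclideanSpace ℝ (Fin 3)) H +
        ENNReal.ofReal (a ^ (2 * ρ)) * cknD a (0 : ℝ × EuclideanSpace ℝ (Fin 3)) p ≤ (c : ℝ≥0∞))
    {V : EuclideanSpace ℝ (Fin 3) → EuclideanSpace ℝ (Fin 3)} {P : EuclideanSpace ℝ (Fin 3) → ℝ}
    (hu : ∀ τ : ℝ, τ < T₁ → u τ = fun x => selfSimilarCollapse (1 / (2 + ρ)) T V τ (x - x₀))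
    (hp : ∀ τ : ℝ, τ < T₁ → p τ = fun x => selfSimilarCollapsePressure (1 / (2 + ρ)) T P τ (x - x₀))
    {ε : ℝ} (hε : ε < 1 / (2 + ρ)) :
    ∃ K L₀ : ℝ, 0 ≤ K ∧ ∀ R : ℝ, L₀ ≤ R →
      volume ({y : EuclideanSpace ℝ (Fin 3) | ‖selfSimilarTransport (1 / (2 + ρ)) 0 V y‖ ≤ ε * ‖y‖} ∩ {y | R ≤ ‖y‖}) ≤
        ENNReal.ofReal (K * R ^ (-3 - 3 * ρ)) := by
  have hγ0 : 0 ≤ 1 / (2 + ρ) := by positivity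
  have ha : 0 < 1 / (2 + ρ) - ε := sub_pos.2 hε
  obtain ⟨K, L₀, hK0, hK⟩ := WeakThin.volume_fastSet_inter_far_le_of_past hρ hρh hT₁ hTT₁ x₀ hsw hH hgauge hu hp ha
  refine ⟨K, L₀, hK0, fun R hR => (measure_mono ?_).trans (hK R hR)⟩
  rintro y ⟨hy, hyR⟩
  exact ⟨norm_ge_of_norm_transport_le hγ0 hy, hyR⟩

/-- **THE HOVERING SET OF AN EXACTLY SELF-SIMILAR CLASS MEMBER IS SOBOLEV-THIN FAR OUT** (origin-centred; binder shape `IsExactlySelfSimilar`;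
`0 < ρ ≤ ½`, `ε < γ = 1/(2+ρ)`). [folklore] -/
theorem volume_hoverSet_inter_far_le_of_selfSimilar {ρ : ℝ} (hρ : 0 < ρ) (hρh : ρ ≤ 1 / 2)
    {u : ℝ → EuclideanSpace ℝ (Fin 3) → EuclideanSpace ℝ (Fin 3)} {p : ℝ → EuclideanSpace ℝ (Fin 3) → ℝ}
    {H : ℝ → EuclideanSpace ℝ (Fin 3) → EuclideanSpace ℝ (Fin 3) →L[ℝ] EuclideanSpace ℝ (Fin 3)} {c : ℝ≥0}
    (hsw : IsSuitableWeakSolutionOn (slab (EuclideanSpace ℝ (Fin 3)) (Iio 0) isOpen_Iio) 0 0 u p)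
    (hH : HasWeakSpatialGradientOn (slab (EuclideanSpace ℝ (Fin 3)) (Iio 0) isOpen_Iio) u H)
    (hgauge : ∀ a : ℝ, 0 < a →
      ENNReal.ofReal (a ^ (2 * ρ)) * cknA a (0 : ℝ × EuclideanSpace ℝ (Fin 3)) u +
          ENNReal.ofReal (a ^ ρ) * cknE a (0 : ℝ × EuclideanSpace ℝ (Fin 3)) H +
        ENNReal.ofReal (a ^ (2 * ρ)) * cknD a (0 : ℝ × EuclideanSpace ℝ (Fin 3)) p ≤ (c : ℝ≥0∞))
    {V : EuclideanSpace ℝ (Fin 3) → EuclideanSpace ℝ (Fin 3)} {P : EuclideanSpace ℝ (Fin 3) → ℝ}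
    (hu : ∀ τ : ℝ, τ < 0 → u τ = selfSimilarCollapse (1 / (2 + ρ)) 0 V τ)
    (hp : ∀ τ : ℝ, τ < 0 → p τ = selfSimilarCollapsePressure (1 / (2 + ρ)) 0 P τ)
    {ε : ℝ} (hε : ε < 1 / (2 + ρ)) :
    ∃ K L₀ : ℝ, 0 ≤ K ∧ ∀ R : ℝ, L₀ ≤ R →
      volume ({y : EuclideanSpace ℝ (Fin 3) | ‖selfSimilarTransport (1 / (2 + ρ)) 0 V y‖ ≤ ε * ‖y‖} ∩ {y | R ≤ ‖y‖}) ≤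
        ENNReal.ofReal (K * R ^ (-3 - 3 * ρ)) := by
  have hu' : ∀ τ : ℝ, τ < 0 → u τ = fun x => selfSimilarCollapse (1 / (2 + ρ)) 0 V τ (x - 0) :=
    fun τ hτ => by rw [hu τ hτ]; funext x; rw [sub_zero]
  have hp' : ∀ τ : ℝ, τ < 0 → p τ = fun x => selfSimilarCollapsePressure (1 / (2 + ρ)) 0 P τ (x - 0) :=
    fun τ hτ => by rw [hp τ hτ]; funext x; rw [sub_zero]
  exact volume_hoverSet_inter_far_le_of_past hρ hρh le_rfl le_rfl 0 hsw hH hgauge hu' hp' hε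

/-- **THE BERNOULLI LEVEL SETS OF A PAST-EXACT SELF-SIMILAR CLASS MEMBER ARE SOBOLEV-THIN FAR OUT** (`0 < ρ ≤ ½`; NO regularity): crux
hypotheses verbatim, exact self-similarity about `(T, x₀)` for `τ < T₁` ⇒ for every level `m` there are `K ≥ 0`, `L₀` with
`vol({ℋ = m} ∩ {R ≤ ‖y‖}) ≤ K R^{−3−3ρ}` for all `R ≥ L₀`: the level set is null off the stagnation set (`volume_level_inter_eq_zero_of_past`)
and the stagnation set is hovering, hence fast for `V`, hence thin. [folklore] -/
theorem volume_level_inter_far_le_of_past {ρ : ℝ} (hρ : 0 < ρ) (hρh : ρ ≤ 1 / 2)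
    {T T₁ : ℝ} (hT₁ : T₁ ≤ 0) (hTT₁ : T₁ ≤ T) (x₀ : EuclideanSpace ℝ (Fin 3))
    {u : ℝ → EuclideanSpace ℝ (Fin 3) → EuclideanSpace ℝ (Fin 3)} {p : ℝ → EuclideanSpace ℝ (Fin 3) → ℝ}
    {H : ℝ → EuclideanSpace ℝ (Fin 3) → EuclideanSpace ℝ (Fin 3) →L[ℝ] EuclideanSpace ℝ (Fin 3)} {c : ℝ≥0}
    (hsw : IsSuitableWeakSolutionOn (slab (EuclideanSpace ℝ (Fin 3)) (Iio 0) isOpen_Iio) 0 0 u p)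
    (hH : HasWeakSpatialGradientOn (slab (EuclideanSpace ℝ (Fin 3)) (Iio 0) isOpen_Iio) u H)
    (hgauge : ∀ a : ℝ, 0 < a →
      ENNReal.ofReal (a ^ (2 * ρ)) * cknA a (0 : ℝ × EuclideanSpace ℝ (Fin 3)) u +
          ENNReal.ofReal (a ^ ρ) * cknE a (0 : ℝ × EuclideanSpace ℝ (Fin 3)) H +
        ENNReal.ofReal (a ^ (2 * ρ)) * cknD a (0 : ℝ × EuclideanSpace ℝ (Fin 3)) p ≤ (c : ℝ≥0∞))
    {V : EuclideanSpace ℝ (Fin 3) → EuclideanSpace ℝ (Fin 3)} {P : EuclideanSpace ℝ (Fin 3) → ℝ}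
    (hu : ∀ τ : ℝ, τ < T₁ → u τ = fun x => selfSimilarCollapse (1 / (2 + ρ)) T V τ (x - x₀))
    (hp : ∀ τ : ℝ, τ < T₁ → p τ = fun x => selfSimilarCollapsePressure (1 / (2 + ρ)) T P τ (x - x₀)) (m : ℝ) :
    ∃ K L₀ : ℝ, 0 ≤ K ∧ ∀ R : ℝ, L₀ ≤ R →
      volume ({y | selfSimilarBernoulli (1 / (2 + ρ)) 0 V P y = m} ∩ {y : EuclideanSpace ℝ (Fin 3) | R ≤ ‖y‖}) ≤
        ENNReal.ofReal (K * R ^ (-3 - 3 * ρ)) := by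
  have hγpos : 0 < 1 / (2 + ρ) := by positivity
  have hγlt : 1 / (2 + ρ) < 1 / 2 := by
    rw [div_lt_div_iff₀ (by linarith) (by norm_num)]; linarith
  -- the level set is null off the stagnation set
  obtain ⟨G, hV6, hG2, hP32, hdiv, hHb, cA, hcA, hA⟩ := renormalizationData_of_past hρ hρh hT₁ hTT₁ x₀ hsw hH hgauge hu hp
  have hnull := volume_level_inter_eq_zero hγpos.le hγlt hV6 hG2 hP32 hdiv hHb hcA hA m
  -- the stagnation set is hovering (`ε = 0 < γ`)
  obtain ⟨K, L₀, hK0, hK⟩ := volume_hoverSet_inter_far_le_of_past hρ hρh hT₁ hTT₁ x₀ hsw hH hgauge hu hp (ε := 0) hγpos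
  refine ⟨K, L₀, hK0, fun R hR => ?_⟩
  set Hb : EuclideanSpace ℝ (Fin 3) → ℝ := selfSimilarBernoulli (1 / (2 + ρ)) 0 V P with hHbdef
  set W : EuclideanSpace ℝ (Fin 3) → EuclideanSpace ℝ (Fin 3) := selfSimilarTransport (1 / (2 + ρ)) 0 V with hWdef
  have hsub : {y | Hb y = m} ∩ {y : EuclideanSpace ℝ (Fin 3) | R ≤ ‖y‖} ⊆
      ({y | Hb y = m} ∩ {y | W y ≠ 0}) ∪ ({y : EuclideanSpace ℝ (Fin 3) | ‖W y‖ ≤ 0 * ‖y‖} ∩ {y | R ≤ ‖y‖}) := by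
    rintro y ⟨hym, hyR⟩
    by_cases hW : W y = 0
    · refine Or.inr ⟨?_, hyR⟩
      show ‖W y‖ ≤ 0 * ‖y‖
      rw [hW, norm_zero, zero_mul]
    · exact Or.inl ⟨hym, hW⟩
  calc volume ({y | Hb y = m} ∩ {y : EuclideanSpace ℝ (Fin 3) | R ≤ ‖y‖})
      ≤ volume (({y | Hb y = m} ∩ {y | W y ≠ 0}) ∪ ({y : EuclideanSpace ℝ (Fin 3) | ‖W y‖ ≤ 0 * ‖y‖} ∩ {y | R ≤ ‖y‖})) :=
        measure_mono hsub
    _ ≤ volume ({y | Hb y = m} ∩ {y | W y ≠ 0}) + volume ({y : EuclideanSpace ℝ (Fin 3) | ‖W y‖ ≤ 0 * ‖y‖} ∩ {y | R ≤ ‖y‖}) :=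
        measure_union_le _ _
    _ ≤ 0 + ENNReal.ofReal (K * R ^ (-3 - 3 * ρ)) := add_le_add hnull.le (hK R hR)
    _ = ENNReal.ofReal (K * R ^ (-3 - 3 * ρ)) := zero_add _

/-- **THE BERNOULLI LEVEL SETS OF AN EXACTLY SELF-SIMILAR CLASS MEMBER ARE SOBOLEV-THIN FAR OUT** (origin-centred; binder shape
`IsExactlySelfSimilar`; `0 < ρ ≤ ½`): for every level `m`, `vol({ℋ = m} ∩ {R ≤ ‖y‖}) ≤ K R^{−3−3ρ}` beyond a radius — although the Bernoulli function of
the genuinely weak member is merely `W^{1,1}_loc`. [folklore] -/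
theorem volume_level_inter_far_le_of_selfSimilar {ρ : ℝ} (hρ : 0 < ρ) (hρh : ρ ≤ 1 / 2)
    {u : ℝ → EuclideanSpace ℝ (Fin 3) → EuclideanSpace ℝ (Fin 3)} {p : ℝ → EuclideanSpace ℝ (Fin 3) → ℝ}
    {H : ℝ → EuclideanSpace ℝ (Fin 3) → EuclideanSpace ℝ (Fin 3) →L[ℝ] EuclideanSpace ℝ (Fin 3)} {c : ℝ≥0}
    (hsw : IsSuitableWeakSolutionOn (slab (EuclideanSpace ℝ (Fin 3)) (Iio 0) isOpen_Iio) 0 0 u p)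
    (hH : HasWeakSpatialGradientOn (slab (EuclideanSpace ℝ (Fin 3)) (Iio 0) isOpen_Iio) u H)
    (hgauge : ∀ a : ℝ, 0 < a →
      ENNReal.ofReal (a ^ (2 * ρ)) * cknA a (0 : ℝ × EuclideanSpace ℝ (Fin 3)) u +
          ENNReal.ofReal (a ^ ρ) * cknE a (0 : ℝ × EuclideanSpace ℝ (Fin 3)) H +
        ENNReal.ofReal (a ^ (2 * ρ)) * cknD a (0 : ℝ × EuclideanSpace ℝ (Fin 3)) p ≤ (c : ℝ≥0∞))
    {V : EuclideanSpace ℝ (Fin 3) → EuclideanSpace ℝ (Fin 3)} {P : EuclideanSpace ℝ (Fin 3) → ℝ}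
    (hu : ∀ τ : ℝ, τ < 0 → u τ = selfSimilarCollapse (1 / (2 + ρ)) 0 V τ)
    (hp : ∀ τ : ℝ, τ < 0 → p τ = selfSimilarCollapsePressure (1 / (2 + ρ)) 0 P τ) (m : ℝ) :
    ∃ K L₀ : ℝ, 0 ≤ K ∧ ∀ R : ℝ, L₀ ≤ R →
      volume ({y | selfSimilarBernoulli (1 / (2 + ρ)) 0 V P y = m} ∩ {y : EuclideanSpace ℝ (Fin 3) | R ≤ ‖y‖}) ≤
        ENNReal.ofReal (K * R ^ (-3 - 3 * ρ)) := by
  have hu' : ∀ τ : ℝ, τ < 0 → u τ = fun x => selfSimilarCollapse (1 / (2 + ρ)) 0 V τ (x - 0) :=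
    fun τ hτ => by rw [hu τ hτ]; funext x; rw [sub_zero]
  have hp' : ∀ τ : ℝ, τ < 0 → p τ = fun x => selfSimilarCollapsePressure (1 / (2 + ρ)) 0 P τ (x - 0) :=
    fun τ hτ => by rw [hp τ hτ]; funext x; rw [sub_zero]
  exact volume_level_inter_far_le_of_past hρ hρh le_rfl le_rfl 0 hsw hH hgauge hu' hp' m

end Member

end WeakRenormalized

end Summit.NavierStokesRegularity.NavierStokesRegularity.Theorems.PowerGaugeEulerLiouville
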